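import Literature.IUT.HodgeTheaters.TemperedCoveringsProofs
import Literature.IUT.HodgeTheaters.TemperedCoveringsSubgraphClosures
import Literature.IUT.HodgeTheaters.TemperedCoveringsCor23iiiProofs
import Literature.IUT.HodgeTheaters.TemperedCoveringsSlimness
import HarnessLib

/-!
# [IUTchI] Corollary 2.3 (i)–(iv) AS TYPED, assembled from the landed kernels: one theorem, named inputs only

Mochizuki, *Inter-universal Teichmüller theory I: construction of Hodge theaters*, kurims
manuscript (May 2020), §2, Corollary 2.3 "Subgroups of Tempered Fundamental Groups Associated to
Sub-semi-graphs", (i)–(iv), pp. 47–49 [cite: Mochizuki2012, Cor 2.3 pp.47-49] (D-0012 claim key;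
series status DISPUTED; nothing of the series is asserted here).  PROOF-ONLY ASSEMBLY (no
definitions, no new mathematics) of the four landed kernel files over abc-iut-L5-t1's
`TemperedCoverings.lean` (p405450), so that the kernel DAG index (plan/KERNEL-DAG-SPEC.md §2 (c)) has
ONE theorem per node to cite and the remaining named inputs of the whole of Cor. 2.3 (i)–(iv) are
read off ONE signature:

* (i) ⇐ Prop. 2.2 for `D.graph` — abc-iut-L5-t11, `cor23i_of_prop22` (`TemperedCoveringsProofs`, p406834);
* (ii) ⇐ the tempered-vs-profinite density facts — abc-iut-L5-d4, `cor23ii_of_density`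
  (`TemperedCoveringsSubgraphClosures`);
* (iii), first sentence ("`Δ̂_{X,ℍ}` is slim") ⇐ the level-wise conclusions over a cofinal tower of
  normal open `J ⊆ Δ̂_X` — abc-iut-w4-d070, `slim_of_cor23Hyp_of_levels` (`TemperedCoveringsSlimness`;
  the (a)-levels from `mem_level_of_comm_of_inputs`);
* (iii), «in particular» (both exact sequences, all centres trivial) and (iv) ⇐ (i), (ii), the
  slimness, `Z(G_k) = 1` ([AbsAnab] Thm. 1.1.1 (ii)) and the outer-descent atoms — abc-iut-w4-d058,
  `cor23iii_of_slim`, `cor23iv_of_slim` (`TemperedCoveringsCor23iiiProofs`, p411765).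

Main declaration: `StableCurveTemperedData.cor23_i_to_iv_of_inputs : … → D.Cor23i ∧ D.Cor23ii ∧
D.Cor23iii ∧ D.Cor23iv`.  Not a discharge of the nodes (the hypotheses are the merge obligations
listed in the four files); typed ≠ discharged; nothing here bears on [IUTchIII] Cor. 3.12.
-/

namespace Literature.IUT.HodgeTheaters

open Pointwise Topology
open Literature.AlgebraicGeometry.Frobenioids (IsSlimGroup)

universe u

namespace StableCurveTemperedData

variable (D : StableCurveTemperedData.{u})

/-- **[IUTchI] Cor. 2.3 (i)–(iv) AS TYPED from named inputs only** (assembly; see the module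
docstring for which seat's kernel supplies which item).  Inputs: Prop. 2.2 for the special-fibre
data `D.graph` (`h22`); the (ii)-interface facts (`Π̂_ℍ = cl Π^tp_ℍ`, `Ker ρ̂ = cl (Ker ρ̂ ∩ Δ^tp_X)`:
`hH`, `hker`); `Z(G_k) = 1` (`hGk`, [AbsAnab] Thm. 1.1.1 (ii)); the outer-descent atoms of the
(i)-«in particular» (`hOutTp`, `hOutHat`); the slimness level-conclusions under (a) / (b) (`hA`,
`hB`) over a cofinal family `J` of normal open subgroups of `Δ̂_X` (`hcof`); topological side
conditions (`Π̂_X`, `Π̂_𝔾` Hausdorff, `Π̂_X` totally disconnected, `Δ̂_X` closed, `ρ̂` continuous).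
[cite: Mochizuki2012, Cor 2.3 pp.47-49] -/
theorem cor23_i_to_iv_of_inputs [T2Space D.PiHat] [TotallyDisconnectedSpace D.PiHat]
    [T2Space D.graph.Hat] (hΔc : IsClosed (D.DeltaHat : Set D.PiHat)) (hρc : Continuous D.ρHat)
    (h22 : D.graph.CommensuratorsOfDecompositionSubgroups)
    (hH : (D.graph.HatH : Set D.graph.Hat) = closure (D.graph.ι '' D.graph.TpH))
    (hker : (D.ρHat.ker : Set D.DeltaHat) ⊆
      closure ((D.ιΔ.range : Set D.DeltaHat) ∩ (D.ρHat.ker : Set D.DeltaHat)))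
    (hGk : Subgroup.center D.Gk = ⊥)
    (hOutTp : ∀ g : D.PiTp, ∃ d : D.DeltaTp, MulAut.conj g • (D.deltaTpH.map D.DeltaTp.subtype) =
      MulAut.conj (d : D.PiTp) • (D.deltaTpH.map D.DeltaTp.subtype))
    (hOutHat : ∀ γ : D.PiHat, ∃ d : D.DeltaHat,
      MulAut.conj γ • (D.deltaHatH.map D.DeltaHat.subtype) =
        MulAut.conj (d : D.PiHat) • (D.deltaHatH.map D.DeltaHat.subtype))
    {I : Type*} (J : I → Subgroup D.DeltaHat)
    (hcof : ∀ W : Subgroup D.DeltaHat, W.Normal → IsOpen (W : Set D.DeltaHat) → ∃ i, J i ≤ W)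
    (hA : (∃ l ∈ D.graph.SigmaHat, l ∉ D.graph.Sigma ∧ l ≠ D.p) →
      ∀ i (a : D.DeltaHat), (∀ x ∈ J i, x ∈ D.deltaHatH → a * x = x * a) → a ∈ J i)
    (hB : D.graph.SigmaHat = {q | q.Prime} →
      ∀ i (a : D.DeltaHat), (∀ x ∈ J i, x ∈ D.deltaHatH → a * x = x * a) → a ∈ J i) :
    D.Cor23i ∧ D.Cor23ii ∧ D.Cor23iii ∧ D.Cor23iv := by
  have hi : D.Cor23i := D.cor23i_of_prop22 h22
  have hii : D.Cor23ii := D.cor23ii_of_density hΔc hρc hH hker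
  have hslim : D.Cor23Hyp → IsSlimGroup D.deltaHatH := D.slim_of_cor23Hyp_of_levels hΔc J hcof hA hB
  exact ⟨hi, hii, D.cor23iii_of_slim hi hii hslim hGk hOutTp hOutHat,
    D.cor23iv_of_slim hi hii hslim hGk hOutTp hOutHat⟩

end StableCurveTemperedData

end Literature.IUT.HodgeTheaters
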